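import Literature.Probability.RandomPlanarGeometry.LSWConvergesNearZero
import Literature.Probability.RandomPlanarGeometry.RestrictionContinuity
import HarnessLib

/-!
# A diagonal principle for the convergence of [LSW] Lemma 3.5

G. F. Lawler, O. Schramm, W. Werner, *Conformal restriction: the chordal case*, J. Amer. Math.
Soc. **16** (2003) 917–955, arXiv:math/0209343 (**[LSW]**), proof of Lemma 3.5, p. 13: "It is
clear that `E_δ → A` as `δ → 0+` in the topology considered above. It thus suffices to
approximate `E_δ`." The implicit diagonal argument — approximants of approximants of `A` are
approximants of `A` — is recorded here for the tree's sequential transcription `LSWConverges`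
(`RestrictionDensity`) of that topology, for `+`-hulls in a common annulus:

* `IsPlusHull.exists_lswConverges_diagonal` — if `J_m → A` and, for each `m`, `B_{m,k} → J_m`
  (`k → ∞`), all `B_{m,k}` being nonempty `+`-hulls in one annulus `{δ ≤ |z| ≤ 1/δ}`, then
  `B_{m_ℓ, k_ℓ} → A` along a suitable sequence of indices.

Proof: test compacts `T_ℓ = {Im z ≥ 1/(ℓ+1), |z| ≤ ℓ+1, dist(z, A) ≥ 1/(ℓ+1)}` exhaust the
compact subsets of `ℍ ∖ A`; choose `m_ℓ` with `T_ℓ ∩ J_{m_ℓ} = ∅` and `|Ψ_{m_ℓ} - Φ| < 1/(ℓ+1)` on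
`T_ℓ`, then `k_ℓ` with `T_ℓ ∩ B_{m_ℓ,k_ℓ} = ∅` and `|Θ_{m_ℓ,k_ℓ} - Ψ_{m_ℓ}| < 1/(ℓ+1)` on `T_ℓ`; the
convergence near `0` is automatic (`IsPlusHull.lswConverges_of_forall_isCompact`,
`LSWConvergesNearZero`). Proof-only file, towards the density clause of Lemma 3.5
(`IsPlusHull.exists_isLSWGenerated_lswConverges`).
-/

noncomputable section

open Set Filter Metric Bornology Complex
open _root_.Topology
open UpperHalfPlane (upperHalfPlaneSet isOpen_upperHalfPlaneSet)

namespace Literature.Probability.RandomPlanarGeometry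

/-! ### Test compacts exhausting `ℍ ∖ A` -/

section TestCompacts

variable {A : Set ℂ}

/-- The test sets `T_ℓ = {Im z ≥ 1/(ℓ+1)} ∩ B̄(0, ℓ+1) ∩ {dist(z, A) ≥ 1/(ℓ+1)}` are compact. [folklore] -/
theorem isCompact_testCompact (A : Set ℂ) (ℓ : ℕ) :
    IsCompact ({z : ℂ | 1 / ((ℓ : ℝ) + 1) ≤ z.im} ∩ closedBall (0 : ℂ) ((ℓ : ℝ) + 1) ∩
      {z : ℂ | 1 / ((ℓ : ℝ) + 1) ≤ infDist z A}) := by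
  refine Metric.isCompact_of_isClosed_isBounded ?_ ?_
  · exact ((isClosed_le continuous_const Complex.continuous_im).inter isClosed_closedBall).inter
      (isClosed_le continuous_const (continuous_infDist_pt A))
  · exact (isBounded_closedBall.subset inter_subset_right).subset inter_subset_left

/-- The test sets lie in `ℍ ∖ A`. [folklore] -/
theorem testCompact_subset (A : Set ℂ) (ℓ : ℕ) :
    ({z : ℂ | 1 / ((ℓ : ℝ) + 1) ≤ z.im} ∩ closedBall (0 : ℂ) ((ℓ : ℝ) + 1) ∩
      {z : ℂ | 1 / ((ℓ : ℝ) + 1) ≤ infDist z A}) ⊆ upperHalfPlaneSet \ A := by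
  rintro z ⟨⟨hz1, -⟩, hz3⟩
  have hpos : (0 : ℝ) < 1 / ((ℓ : ℝ) + 1) := by positivity
  refine ⟨show 0 < z.im from hpos.trans_le hz1, fun hzA ↦ ?_⟩
  have : infDist z A = 0 := infDist_zero_of_mem hzA
  simp only [mem_setOf_eq, this] at hz3
  linarith

/-- The test sets increase with `ℓ`. [folklore] -/
theorem testCompact_mono (A : Set ℂ) {ℓ ℓ' : ℕ} (h : ℓ ≤ ℓ') :
    ({z : ℂ | 1 / ((ℓ : ℝ) + 1) ≤ z.im} ∩ closedBall (0 : ℂ) ((ℓ : ℝ) + 1) ∩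
      {z : ℂ | 1 / ((ℓ : ℝ) + 1) ≤ infDist z A}) ⊆
    ({z : ℂ | 1 / ((ℓ' : ℝ) + 1) ≤ z.im} ∩ closedBall (0 : ℂ) ((ℓ' : ℝ) + 1) ∩
      {z : ℂ | 1 / ((ℓ' : ℝ) + 1) ≤ infDist z A}) := by
  have hℓ : (ℓ : ℝ) ≤ ℓ' := by exact_mod_cast h
  have h1 : 1 / ((ℓ' : ℝ) + 1) ≤ 1 / ((ℓ : ℝ) + 1) := by
    gcongr
  rintro z ⟨⟨hz1, hz2⟩, hz3⟩
  refine ⟨⟨h1.trans hz1, closedBall_subset_closedBall (by linarith) hz2⟩, h1.trans hz3⟩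

/-- **Exhaustion**: every compact subset of `ℍ ∖ A` (`A` closed and nonempty) lies in some test
set `T_ℓ`. [folklore] -/
theorem exists_subset_testCompact (hAc : IsClosed A) (hAne : A.Nonempty) {S : Set ℂ}
    (hS : IsCompact S) (hSA : S ⊆ upperHalfPlaneSet \ A) :
    ∃ ℓ : ℕ, S ⊆ ({z : ℂ | 1 / ((ℓ : ℝ) + 1) ≤ z.im} ∩ closedBall (0 : ℂ) ((ℓ : ℝ) + 1) ∩
      {z : ℂ | 1 / ((ℓ : ℝ) + 1) ≤ infDist z A}) := by
  rcases S.eq_empty_or_nonempty with rfl | hSne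
  · exact ⟨0, empty_subset _⟩
  -- positive lower bounds for `im` and `dist(·, A)` on `S`, and an upper bound for the norm
  obtain ⟨z₁, hz₁, hmin₁⟩ := hS.exists_isMinOn hSne Complex.continuous_im.continuousOn
  obtain ⟨z₂, hz₂, hmin₂⟩ := hS.exists_isMinOn hSne (continuous_infDist_pt A).continuousOn
  obtain ⟨R, hR⟩ := hS.isBounded.subset_closedBall 0
  have him : 0 < z₁.im := (hSA hz₁).1
  have hd : 0 < infDist z₂ A :=
    (infDist_pos_iff_notMem_closure hAne).1 (by rw [hAc.closure_eq]; exact (hSA hz₂).2)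
  obtain ⟨ℓ, hℓ⟩ := exists_nat_gt (max (max (1 / z₁.im) (1 / infDist z₂ A)) R)
  have hℓ0 : (0 : ℝ) < (ℓ : ℝ) + 1 := by positivity
  refine ⟨ℓ, fun z hz ↦ ⟨⟨?_, ?_⟩, ?_⟩⟩
  · have h1 : z₁.im ≤ z.im := hmin₁ hz
    have h2 : 1 / z₁.im < (ℓ : ℝ) + 1 := by
      linarith [le_max_left (max (1 / z₁.im) (1 / infDist z₂ A)) R, le_max_left (1 / z₁.im) (1 / infDist z₂ A)]
    have h3 : 1 / ((ℓ : ℝ) + 1) < z₁.im := by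
      rw [div_lt_iff₀ hℓ0]
      rw [div_lt_iff₀ him] at h2
      linarith
    exact (h3.trans_le h1).le
  · have := hR hz
    rw [mem_closedBall_zero_iff] at this ⊢
    linarith [le_max_right (max (1 / z₁.im) (1 / infDist z₂ A)) R]
  · have h1 : infDist z₂ A ≤ infDist z A := hmin₂ hz
    have h2 : 1 / infDist z₂ A < (ℓ : ℝ) + 1 := by
      linarith [le_max_left (max (1 / z₁.im) (1 / infDist z₂ A)) R, le_max_right (1 / z₁.im) (1 / infDist z₂ A)]
    have h3 : 1 / ((ℓ : ℝ) + 1) < infDist z₂ A := by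
      rw [div_lt_iff₀ hℓ0]
      rw [div_lt_iff₀ hd] at h2
      linarith
    exact (h3.trans_le h1).le

end TestCompacts

/-! ### The diagonal principle -/

section Diagonal

variable {A : Set ℂ} {Φ : ConformalEquiv (upperHalfPlaneSet \ A) upperHalfPlaneSet}
  {J : ℕ → Set ℂ} {Ψ : ∀ m, ConformalEquiv (upperHalfPlaneSet \ J m) upperHalfPlaneSet}
  {B : ℕ → ℕ → Set ℂ} {Θ : ∀ m k, ConformalEquiv (upperHalfPlaneSet \ B m k) upperHalfPlaneSet}

/-- **Diagonal principle for `LSWConverges`** (the implicit "it thus suffices to approximate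
`E_δ`" of [LSW] p. 13): if `J_m → A` and `B_{m,k} → J_m` for each `m`, with all `B_{m,k}`
nonempty `+`-hulls in a common annulus, then `B_{m_ℓ,k_ℓ} → A` for suitable indices.
[cite: LawlerSchrammWerner2003Restriction, proof of Lemma 3.5 (p. 13), "It thus suffices to approximate E_δ"] -/
theorem IsPlusHull.exists_lswConverges_diagonal (hA : IsPlusHull A) (hne : A.Nonempty)
    (hΦ : IsRestrictionMap A Φ) (hJA : LSWConverges A Φ J Ψ)
    (hB : ∀ m k, IsPlusHull (B m k)) (hBne : ∀ m k, (B m k).Nonempty)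
    (hΘ : ∀ m k, IsRestrictionMap (B m k) (Θ m k))
    (hBJ : ∀ m, LSWConverges (J m) (Ψ m) (B m) (Θ m))
    {δ : ℝ} (hδ : 0 < δ) (hBδ : ∀ m k, B m k ⊆ {z : ℂ | δ ≤ ‖z‖ ∧ ‖z‖ ≤ δ⁻¹}) :
    ∃ κ : ℕ → ℕ × ℕ,
      LSWConverges A Φ (fun ℓ ↦ B (κ ℓ).1 (κ ℓ).2) (fun ℓ ↦ Θ (κ ℓ).1 (κ ℓ).2) := by
  have hAc : IsClosed A := hA.1.isBoundedHull.isClosed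
  -- the test compacts
  set T : ℕ → Set ℂ := fun ℓ ↦ {z : ℂ | 1 / ((ℓ : ℝ) + 1) ≤ z.im} ∩ closedBall (0 : ℂ) ((ℓ : ℝ) + 1) ∩
      {z : ℂ | 1 / ((ℓ : ℝ) + 1) ≤ infDist z A} with hT
  have hTc : ∀ ℓ, IsCompact (T ℓ) := fun ℓ ↦ isCompact_testCompact A ℓ
  have hTA : ∀ ℓ, T ℓ ⊆ upperHalfPlaneSet \ A := fun ℓ ↦ testCompact_subset A ℓ
  have hTm : Monotone T := fun ℓ ℓ' h ↦ testCompact_mono A h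
  -- choice of `m_ℓ`: `T_ℓ` misses `J_m` and `Ψ_m` is `1/(ℓ+1)`-close to `Φ` on `T_ℓ`
  have hm : ∀ ℓ : ℕ, ∃ m : ℕ, Disjoint (T ℓ) (J m) ∧
      ∀ z ∈ T ℓ, dist (Φ z) (Ψ m z) < 1 / ((ℓ : ℝ) + 1) := fun ℓ ↦ by
    obtain ⟨h1, h2⟩ := hJA.2.1 (T ℓ) (hTc ℓ) (hTA ℓ)
    rw [Metric.tendstoUniformlyOn_iff] at h2
    exact (h1.and (h2 _ (by positivity))).exists
  choose m hmJ hmΨ using hm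
  -- choice of `k_ℓ`: `T_ℓ` misses `B_{m_ℓ,k}` and `Θ_{m_ℓ,k}` is `1/(ℓ+1)`-close to `Ψ_{m_ℓ}` on `T_ℓ`
  have hk : ∀ ℓ : ℕ, ∃ k : ℕ, Disjoint (T ℓ) (B (m ℓ) k) ∧
      ∀ z ∈ T ℓ, dist (Ψ (m ℓ) z) (Θ (m ℓ) k z) < 1 / ((ℓ : ℝ) + 1) := fun ℓ ↦ by
    have hTJ : T ℓ ⊆ upperHalfPlaneSet \ J (m ℓ) := fun z hz ↦
      ⟨(hTA ℓ hz).1, fun h ↦ Set.disjoint_left.1 (hmJ ℓ) hz h⟩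
    obtain ⟨h1, h2⟩ := (hBJ (m ℓ)).2.1 (T ℓ) (hTc ℓ) hTJ
    rw [Metric.tendstoUniformlyOn_iff] at h2
    exact (h1.and (h2 _ (by positivity))).exists
  choose k hkB hkΘ using hk
  refine ⟨fun ℓ ↦ (m ℓ, k ℓ), ?_⟩
  -- a common annulus for `A` and the `B`
  obtain ⟨δ₁, hδ₁, hAδ₁⟩ := hA.1.exists_subset_norm_annulus
  set δ' := min δ δ₁ with hδ'
  have hδ'0 : 0 < δ' := lt_min hδ hδ₁
  have hann : ∀ {δ₀ : ℝ} {S : Set ℂ}, δ' ≤ δ₀ → 0 < δ₀ → S ⊆ {z : ℂ | δ₀ ≤ ‖z‖ ∧ ‖z‖ ≤ δ₀⁻¹} →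
      S ⊆ {z : ℂ | δ' ≤ ‖z‖ ∧ ‖z‖ ≤ δ'⁻¹} := fun {δ₀ S} hle h0 hS z hz ↦
    ⟨hle.trans (hS hz).1, (hS hz).2.trans ((inv_le_inv₀ h0 hδ'0).2 hle)⟩
  refine hA.lswConverges_of_forall_isCompact hne hΦ (fun ℓ ↦ hB _ _) (fun ℓ ↦ hBne _ _)
    (fun ℓ ↦ hΘ _ _) hδ'0 (hann (min_le_right _ _) hδ₁ hAδ₁)
    (fun ℓ ↦ hann (min_le_left _ _) hδ (hBδ _ _)) fun S hS hSA ↦ ?_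
  -- compacts of `ℍ ∖ A` lie in some `T_L`
  obtain ⟨L, hL⟩ := exists_subset_testCompact hAc hne hS hSA
  refine ⟨?_, ?_⟩
  · filter_upwards [eventually_ge_atTop L] with ℓ hℓ
    exact (hkB ℓ).mono_left (hL.trans (hTm hℓ))
  · rw [Metric.tendstoUniformlyOn_iff]
    intro ε hε
    obtain ⟨L', hL'⟩ := exists_nat_gt (2 / ε)
    filter_upwards [eventually_ge_atTop L, eventually_ge_atTop L'] with ℓ hℓ hℓ' z hzS
    have hzT : z ∈ T ℓ := hTm hℓ (hL hzS)
    have h1 := hmΨ ℓ z hzT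
    have h2 := hkΘ ℓ z hzT
    have hℓ0 : (0 : ℝ) < (ℓ : ℝ) + 1 := by positivity
    have h3 : 2 / ((ℓ : ℝ) + 1) < ε := by
      rw [div_lt_iff₀ hℓ0]
      rw [div_lt_iff₀ hε] at hL'
      have : (L' : ℝ) ≤ ℓ := by exact_mod_cast hℓ'
      nlinarith
    calc dist (Φ z) (Θ (m ℓ) (k ℓ) z)
        ≤ dist (Φ z) (Ψ (m ℓ) z) + dist (Ψ (m ℓ) z) (Θ (m ℓ) (k ℓ) z) := dist_triangle _ _ _
      _ < 1 / ((ℓ : ℝ) + 1) + 1 / ((ℓ : ℝ) + 1) := add_lt_add h1 h2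
      _ = 2 / ((ℓ : ℝ) + 1) := by ring
      _ < ε := h3

end Diagonal

end Literature.Probability.RandomPlanarGeometry

end
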